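import Summits.QuantumFields.YangMills.Theorems.BalabanLadderInfVolFloorsCore

/-!
# Crux `IR` (stmt-QuantumFields-19354), line `af-pincer`, stub `stub_afOnsetUc : AFToOnsetUKPc` (X-side):
# the LARGE-UNIT end of the stub — `Q2` at unit `s` is `O(1/s)` uniformly in `β` and in the torus

Helper for the X-stub of the registered slot `af-pincer-Uc` (`pub/ym-beyond/p2-g28-files/line-af-pincer-Uc.reg.lean`,
sha16 b6e69d9662b5b07a, namespace `…Cruxes.IR.AfPincerUc`).  The stub reads

  `AFToOnsetUKPc`: for every admissible `(n, ε)`, every `δ > 0`, every real test function `v` supported at positive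
  times and every `η > 0` there are `T, β₁` with: `β ≥ β₁`, `s > 0`, `T ≤ s · b⋆(β)` ⟹ `|Q2 G r β L s (θv) v| ≤ η`
  frequently in `L`, where `b⋆(β) = mixOnsetUc r.ρ β n ε δ` is the onset mesh of format Uc.

This file settles, sorry-free and FORMAT-INDEPENDENTLY, the end of the stub where the unit `s` is large:

* §1 `exists_sum_abs_schwartz_lattice_le` — for a Schwartz `f` on `ℝ⁴`: `Σ_{x ∈ T} |f(s x)| ≤ |f 0| + K_f / s` for
  every finite `T ⊆ ℤ⁴` and every unit `s ≥ 1` (Schwartz decay of order 7 off the origin + the tree's lattice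
  Riemann-sum bound `OSLegsFromFemtoAndGap.sum_decay_le` at `a = 1`).
* §2 `exists_abs_Q2_le_div` — if `g 0 = 0` then `|Q2 G r β L s f g| ≤ K / s` for all `β`, all tori `L`, all `s ≥ 1`
  (`K` depends on `r, f, g` only; covariances bounded by `2C²`, tree `InfiniteVolume.abs_torusCov_dens_le`);
  `exists_unit_forall_abs_Q2_le` — hence `∀ η > 0 ∃ s₀ ≥ 1`, `|Q2| ≤ η` at every unit `s ≥ s₀`, uniformly in `β, L`;
  `apply_zero_eq_zero_of_tsupport_subset` + `exists_unit_forall_abs_Q2_thetaTest_le` — the stub's pair `(θv, v)`.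
* §3 `afToOnset_clause_of_bddOnset` — THE BOUNDED-ONSET REGIME OF THE STUB: for ANY onset function `b⋆ : ℝ → ℕ`
  bounded on a tail `[β₀, ∞)` the X-clause `∃ T β₁, ∀ β ≥ β₁, ∀ s > 0, T ≤ s · b⋆ β → ∃ᶠ L, |Q2 … (θv) v| ≤ η` holds
  (take `T = s₀ · (M+1)`); in particular it holds when the format is met at NO mesh eventually (`b⋆ = sInf ∅ = 0`) and
  when it is met at a bounded mesh.  So `AFToOnsetUKPc` has content only where `b⋆(β) → ∞` along a sequence — by the
  tree's fixed-mesh negatives (`Theorems/IR/Negative/TypShellCondFalseFixedMesh`, R66) exactly the regime the supplier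
  `stub_onsetUc` must live in.

HONEST FRAMING.  Elementary real analysis over tree objects; nothing about Yang–Mills is asserted; the stub itself
(«mixing follows interaction», owner's `XT-ANATOMY-g27.md`) is NOT proved here.  One open gap-crux of a CONDITIONAL chain.
-/

set_option autoImplicit false

noncomputable section

open MeasureTheory Filter Topology Finset
open scoped BigOperators SchwartzMap
open Literature.MathematicalPhysics.QuantumFieldTheory hiding ZdEdge
open Literature.MathematicalPhysics.QuantumLattice
open Literature.Probability.LatticeModels (Site box mem_box)
open Summit.QuantumFields.YangMills.Cruxes.OSLegsFromFemtoAndGap.DlrCollarTransfer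
open Summit.QuantumFields.YangMills.Theorems.OSLegsFromFemtoAndGap (sum_decay_le summable_inv_succ_sq
  mul_norm_le_norm_smul_siteToE)
open Summit.QuantumFields.YangMills.Theorems.InfiniteVolume (exists_abs_dens_le_uniform abs_torusCov_dens_le)

namespace Summit.QuantumFields.YangMills.Cruxes.IR.AfOnset


/-! ## §1 Schwartz weights on the lattice of unit `s ≥ 1`: `|f 0| + O(1/s)` -/
section Schwartz

/-- The origin of `ℤ⁴` embeds to the origin of `ℝ⁴`. [folklore] -/
theorem siteToE_zero : siteToE (0 : Site 4) = 0 := by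
  ext i
  simp [siteToE_apply]

/-- A non-zero site of `ℤ⁴` has sup norm at least `1`. [folklore] -/
theorem one_le_norm_of_site_ne_zero {x : Site 4} (hx : x ≠ 0) : (1 : ℝ) ≤ ‖x‖ := by
  obtain ⟨i, hi⟩ := Function.ne_iff.1 hx
  have h1 : (1 : ℝ) ≤ ‖x i‖ := by
    rw [Int.norm_eq_abs]
    exact_mod_cast Int.one_le_abs hi
  exact h1.trans (norm_le_pi_norm x i)

/-- **Schwartz weights off the origin are `O(1/s)` on the lattice of unit `s ≥ 1`**: for a Schwartz function `f` on
`ℝ⁴` there is `K ≥ 0` with `Σ_{x ∈ T} |f(s x)| ≤ |f 0| + K / s` for every finite `T ⊆ ℤ⁴` and every `s ≥ 1`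
(decay `|f y| ≤ M (1+‖y‖)⁻⁷`, `(1 + s‖x‖)⁷ ≥ s (1+‖x‖)⁶` for `x ≠ 0`, and `Σ (1+‖x‖)⁻⁶ ≤ 81 Σ (m+1)⁻²`). [folklore] -/
theorem exists_sum_abs_schwartz_lattice_le (f : 𝓢((EuclideanSpace ℝ (Fin 4)), ℝ)) :
    ∃ K : ℝ, 0 ≤ K ∧ ∀ s : ℝ, 1 ≤ s → ∀ T : Finset (Site 4),
      ∑ x ∈ T, |f (s • siteToE x)| ≤ |f 0| + K / s := by
  classical
  set M : ℝ := 2 ^ (7, 0).1 * (Finset.Iic (7, 0)).sup (fun m => SchwartzMap.seminorm ℝ m.1 m.2) f with hM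
  have hM0 : 0 ≤ M := by positivity
  set Z : ℝ := 81 * ∑' m : ℕ, (((m : ℝ) + 1) ^ 2)⁻¹ with hZ
  have hZ0 : 0 ≤ Z := by
    have : 0 ≤ ∑' m : ℕ, (((m : ℝ) + 1) ^ 2)⁻¹ := tsum_nonneg fun m => by positivity
    positivity
  -- Schwartz decay of order 7
  have hdecay : ∀ y : (EuclideanSpace ℝ (Fin 4)), |f y| ≤ M * ((1 + ‖y‖) ^ 7)⁻¹ := by
    intro y
    have h := SchwartzMap.one_add_le_sup_seminorm_apply (𝕜 := ℝ) (m := (7, 0)) (k := 7) (n := 0)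
      le_rfl le_rfl f y
    rw [norm_iteratedFDeriv_zero, Real.norm_eq_abs] at h
    have hpos : 0 < (1 + ‖y‖) ^ 7 := by positivity
    rw [← div_eq_mul_inv, le_div_iff₀ hpos, mul_comm]
    exact h
  refine ⟨M * Z, mul_nonneg hM0 hZ0, fun s hs T => ?_⟩
  have hs0 : 0 < s := lt_of_lt_of_le one_pos hs
  -- pointwise bound off the origin
  have hoff : ∀ x : Site 4, x ≠ 0 →
      |f (s • siteToE x)| ≤ M / s * ((1 : ℝ) ^ 4 * ((1 + 1 * ‖x‖) ^ 6)⁻¹) := by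
    intro x hx
    have hx1 : (1 : ℝ) ≤ ‖x‖ := one_le_norm_of_site_ne_zero hx
    have h2 : s * ‖x‖ ≤ ‖s • siteToE x‖ := mul_norm_le_norm_smul_siteToE hs0.le x
    have h3 : s * (1 + ‖x‖) ^ 6 ≤ (1 + ‖s • siteToE x‖) ^ 7 := by
      have h4 : s ≤ 1 + s * ‖x‖ := by nlinarith
      have h5 : 1 + ‖x‖ ≤ 1 + s * ‖x‖ := by nlinarith
      have h6 : (1 + ‖x‖) ^ 6 ≤ (1 + s * ‖x‖) ^ 6 := pow_le_pow_left₀ (by positivity) h5 6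
      have h7 : (1 + s * ‖x‖) ^ 7 ≤ (1 + ‖s • siteToE x‖) ^ 7 :=
        pow_le_pow_left₀ (by positivity) (by linarith) 7
      calc s * (1 + ‖x‖) ^ 6 ≤ (1 + s * ‖x‖) * (1 + s * ‖x‖) ^ 6 :=
            mul_le_mul h4 h6 (by positivity) (by positivity)
        _ = (1 + s * ‖x‖) ^ 7 := by ring
        _ ≤ (1 + ‖s • siteToE x‖) ^ 7 := h7
    have hpos6 : 0 < s * (1 + ‖x‖) ^ 6 := by positivity
    calc |f (s • siteToE x)| ≤ M * ((1 + ‖s • siteToE x‖) ^ 7)⁻¹ := hdecay _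
      _ ≤ M * (s * (1 + ‖x‖) ^ 6)⁻¹ := mul_le_mul_of_nonneg_left (inv_anti₀ hpos6 h3) hM0
      _ = M / s * ((1 : ℝ) ^ 4 * ((1 + 1 * ‖x‖) ^ 6)⁻¹) := by
          field_simp
  -- pointwise bound everywhere: origin term + decaying term
  have hpt : ∀ x ∈ T, |f (s • siteToE x)| ≤
      (if x = 0 then |f 0| else 0) + M / s * ((1 : ℝ) ^ 4 * ((1 + 1 * ‖x‖) ^ 6)⁻¹) := by
    intro x _
    by_cases hx : x = 0
    · subst hx
      rw [if_pos rfl, siteToE_zero, smul_zero]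
      have : 0 ≤ M / s * ((1 : ℝ) ^ 4 * ((1 + 1 * ‖(0 : Site 4)‖) ^ 6)⁻¹) := by positivity
      linarith
    · rw [if_neg hx, zero_add]
      exact hoff x hx
  calc ∑ x ∈ T, |f (s • siteToE x)|
      ≤ ∑ x ∈ T, ((if x = 0 then |f 0| else 0) + M / s * ((1 : ℝ) ^ 4 * ((1 + 1 * ‖x‖) ^ 6)⁻¹)) :=
        Finset.sum_le_sum hpt
    _ = (∑ x ∈ T, if x = 0 then |f 0| else 0) +
          M / s * ∑ x ∈ T, (1 : ℝ) ^ 4 * ((1 + 1 * ‖x‖) ^ 6)⁻¹ := by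
        rw [Finset.sum_add_distrib, Finset.mul_sum]
    _ ≤ |f 0| + M / s * Z := by
        gcongr
        · rw [Finset.sum_ite_eq' T (0 : Site 4) (fun _ => |f 0|)]
          split_ifs
          · exact le_rfl
          · exact abs_nonneg _
        · exact sum_decay_le one_pos le_rfl (p := 6) le_rfl T
    _ = |f 0| + M * Z / s := by ring

end Schwartz

/-! ## §2 `Q2` at a large unit is small, uniformly in the coupling and in the torus -/
section Q2

variable {G : Type} [Group G] [TopologicalSpace G] [IsTopologicalGroup G] [CompactSpace G]
  [MeasurableSpace G] [BorelSpace G] (r : LatticeRep G)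

/-- **`Q2` is `O(1/s)` at large unit** when the second test function vanishes at the origin: there is `K ≥ 0`
(depending on `r, f, g` only) with `|Q2 G r β L s f g| ≤ K / s` for every `β`, every torus `L` and every `s ≥ 1`.
Proof: `|Cov| ≤ 2C²` (tree), so `|Q2| ≤ 2C² (Σ|f(s x)|)(Σ|g(s y)|) ≤ 2C² (|f 0| + K_f)(K_g / s)`. [folklore] -/
theorem exists_abs_Q2_le_div (f g : 𝓢((EuclideanSpace ℝ (Fin 4)), ℝ)) (hg : g 0 = 0) :
    ∃ K : ℝ, 0 ≤ K ∧ ∀ (β : ℝ) (L : ℕ) (s : ℝ), 1 ≤ s → |Q2 G r β L s f g| ≤ K / s := by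
  classical
  obtain ⟨C, hC0, hC⟩ := exists_abs_dens_le_uniform (G := G) r
  obtain ⟨Kf, hKf0, hKf⟩ := exists_sum_abs_schwartz_lattice_le f
  obtain ⟨Kg, hKg0, hKg⟩ := exists_sum_abs_schwartz_lattice_le g
  refine ⟨2 * C ^ 2 * (|f 0| + Kf) * Kg, by positivity, fun β L s hs => ?_⟩
  have hs0 : 0 < s := lt_of_lt_of_le one_pos hs
  -- termwise bound
  have hterm : ∀ x ∈ box 4 L, ∀ y ∈ box 4 L,
      |f (s • siteToE x) * g (s • siteToE y) *
        (torusE G r β L (fun U => dens G r x U * dens G r y U) -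
          torusE G r β L (dens G r x) * torusE G r β L (dens G r y))| ≤
      |f (s • siteToE x)| * |g (s • siteToE y)| * (2 * C ^ 2) := by
    intro x _ y _
    rw [abs_mul, abs_mul]
    exact mul_le_mul_of_nonneg_left (abs_torusCov_dens_le r hC0 hC β L x y)
      (mul_nonneg (abs_nonneg _) (abs_nonneg _))
  have hF : ∑ x ∈ box 4 L, |f (s • siteToE x)| ≤ |f 0| + Kf / s := hKf s hs _
  have hGs : ∑ y ∈ box 4 L, |g (s • siteToE y)| ≤ Kg / s := by
    have h := hKg s hs (box 4 L)
    rw [hg, abs_zero, zero_add] at h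
    exact h
  have hF' : |f 0| + Kf / s ≤ |f 0| + Kf := by
    have : Kf / s ≤ Kf := div_le_self hKf0 hs
    linarith
  have hFn : 0 ≤ ∑ x ∈ box 4 L, |f (s • siteToE x)| := Finset.sum_nonneg fun _ _ => abs_nonneg _
  have hGn : 0 ≤ ∑ y ∈ box 4 L, |g (s • siteToE y)| := Finset.sum_nonneg fun _ _ => abs_nonneg _
  unfold Q2
  calc |∑ x ∈ box 4 L, ∑ y ∈ box 4 L, f (s • siteToE x) * g (s • siteToE y) *
          (torusE G r β L (fun U => dens G r x U * dens G r y U) -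
            torusE G r β L (dens G r x) * torusE G r β L (dens G r y))|
      ≤ ∑ x ∈ box 4 L, |∑ y ∈ box 4 L, f (s • siteToE x) * g (s • siteToE y) *
          (torusE G r β L (fun U => dens G r x U * dens G r y U) -
            torusE G r β L (dens G r x) * torusE G r β L (dens G r y))| :=
        Finset.abs_sum_le_sum_abs _ _
    _ ≤ ∑ x ∈ box 4 L, ∑ y ∈ box 4 L, |f (s • siteToE x) * g (s • siteToE y) *
          (torusE G r β L (fun U => dens G r x U * dens G r y U) -
            torusE G r β L (dens G r x) * torusE G r β L (dens G r y))| :=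
        Finset.sum_le_sum fun x _ => Finset.abs_sum_le_sum_abs _ _
    _ ≤ ∑ x ∈ box 4 L, ∑ y ∈ box 4 L, |f (s • siteToE x)| * |g (s • siteToE y)| * (2 * C ^ 2) :=
        Finset.sum_le_sum fun x hx => Finset.sum_le_sum fun y hy => hterm x hx y hy
    _ = (∑ x ∈ box 4 L, |f (s • siteToE x)|) * (∑ y ∈ box 4 L, |g (s • siteToE y)|) * (2 * C ^ 2) := by
        rw [Finset.sum_mul_sum, Finset.sum_mul]
        refine Finset.sum_congr rfl fun x _ => ?_
        rw [Finset.sum_mul]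
    _ ≤ (|f 0| + Kf) * (Kg / s) * (2 * C ^ 2) := by
        gcongr
        exact hF.trans hF'
    _ = 2 * C ^ 2 * (|f 0| + Kf) * Kg / s := by ring

/-- **At every large unit `Q2` is small, uniformly in `β` and `L`**: if `g 0 = 0` then for every `η > 0` there is
`s₀ ≥ 1` with `|Q2 G r β L s f g| ≤ η` for all `β`, all `L`, all `s ≥ s₀`. [folklore] -/
theorem exists_unit_forall_abs_Q2_le (f g : 𝓢((EuclideanSpace ℝ (Fin 4)), ℝ)) (hg : g 0 = 0) {η : ℝ}
    (hη : 0 < η) :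
    ∃ s₀ : ℝ, 1 ≤ s₀ ∧ ∀ (β : ℝ) (L : ℕ) (s : ℝ), s₀ ≤ s → |Q2 G r β L s f g| ≤ η := by
  obtain ⟨K, hK0, hK⟩ := exists_abs_Q2_le_div r f g hg
  refine ⟨max 1 (K / η), le_max_left _ _, fun β L s hs => ?_⟩
  have hs1 : 1 ≤ s := le_trans (le_max_left _ _) hs
  have hs0 : 0 < s := lt_of_lt_of_le one_pos hs1
  refine (hK β L s hs1).trans ?_
  rw [div_le_iff₀ hs0]
  have h1 : K / η ≤ s := le_trans (le_max_right _ _) hs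
  have h2 : K ≤ η * (K / η) := by field_simp; exact le_rfl
  calc K ≤ η * (K / η) := h2
    _ ≤ η * s := mul_le_mul_of_nonneg_left h1 hη.le

/-- A test function supported at positive times vanishes at the origin. [folklore] -/
theorem apply_zero_eq_zero_of_tsupport_subset (v : 𝓢((EuclideanSpace ℝ (Fin 4)), ℝ))
    (hv : tsupport v ⊆ {y : (EuclideanSpace ℝ (Fin 4)) | 0 < y 0}) :
    v 0 = 0 := by
  apply image_eq_zero_of_notMem_tsupport
  intro h
  have h0 := hv h
  simp at h0

/-- **The stub's pair `(θv, v)`**: for `v` supported at positive times and every `η > 0` there is `s₀ ≥ 1` with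
`|Q2 G r β L s (θv) v| ≤ η` for all `β`, all `L`, all units `s ≥ s₀`. [folklore] -/
theorem exists_unit_forall_abs_Q2_thetaTest_le (v : 𝓢((EuclideanSpace ℝ (Fin 4)), ℝ))
    (hv : tsupport v ⊆ {y : (EuclideanSpace ℝ (Fin 4)) | 0 < y 0})
    {η : ℝ} (hη : 0 < η) :
    ∃ s₀ : ℝ, 1 ≤ s₀ ∧ ∀ (β : ℝ) (L : ℕ) (s : ℝ), s₀ ≤ s → |Q2 G r β L s (thetaTest 4 v) v| ≤ η :=
  exists_unit_forall_abs_Q2_le r (thetaTest 4 v) v (apply_zero_eq_zero_of_tsupport_subset v hv) hη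

end Q2

/-! ## §3 The bounded-onset regime of the X-clause (any format) -/
section Onset

variable {G : Type} [Group G] [TopologicalSpace G] [IsTopologicalGroup G] [CompactSpace G]
  [MeasurableSpace G] [BorelSpace G] (r : LatticeRep G)

/-- **Bounded onset ⟹ the X-clause.**  For ANY onset function `b⋆ : ℝ → ℕ` that is bounded by `M` on a tail
`[β₀, ∞)`, every `v` supported at positive times and every `η > 0`: there are `T, β₁` such that `β ≥ β₁`, `s > 0`
and `T ≤ s · b⋆ β` force `|Q2 G r β L s (θv) v| ≤ η` frequently (indeed for every) `L`.  Witness `T = s₀ · (M+1)`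
with `s₀` from `exists_unit_forall_abs_Q2_thetaTest_le`: then `T ≤ s · b⋆ β ≤ s · (M+1)` gives `s ≥ s₀`.  This is the
shape of `AfPincerUc.AFToOnsetUKPc` after its eleven outer binders, with `b⋆ β = mixOnsetUc r.ρ β n ε δ`; it covers
the cases «format met at no mesh eventually» (`b⋆ = 0`, the clause is vacuous) and «format met at a bounded mesh».
[folklore] -/
theorem afToOnset_clause_of_bddOnset (bstar : ℝ → ℕ) {M : ℕ} {β₀ : ℝ} (hbdd : ∀ β : ℝ, β₀ ≤ β → bstar β ≤ M)
    (v : 𝓢((EuclideanSpace ℝ (Fin 4)), ℝ)) (hv : tsupport v ⊆ {y : (EuclideanSpace ℝ (Fin 4)) | 0 < y 0})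
    {η : ℝ} (hη : 0 < η) :
    ∃ T β₁ : ℝ, ∀ β : ℝ, β₁ ≤ β → ∀ s : ℝ, 0 < s → T ≤ s * (bstar β : ℝ) →
      ∃ᶠ (L : ℕ) in atTop, |Q2 G r β L s (thetaTest 4 v) v| ≤ η := by
  obtain ⟨s₀, hs₀, hQ⟩ := exists_unit_forall_abs_Q2_thetaTest_le r v hv hη
  refine ⟨s₀ * ((M : ℝ) + 1), β₀, fun β hβ s hs hT => ?_⟩
  have hbM : (bstar β : ℝ) ≤ (M : ℝ) + 1 := by
    have h := hbdd β hβ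
    have h' : (bstar β : ℝ) ≤ (M : ℝ) := by exact_mod_cast h
    linarith
  have hM1 : (0 : ℝ) < (M : ℝ) + 1 := by positivity
  have hs₀s : s₀ ≤ s := by
    have h1 : s₀ * ((M : ℝ) + 1) ≤ s * ((M : ℝ) + 1) :=
      hT.trans (mul_le_mul_of_nonneg_left hbM hs.le)
    exact le_of_mul_le_mul_right h1 hM1
  exact Filter.Eventually.frequently (Filter.Eventually.of_forall fun L => hQ β L s hs₀s)

/-- **Format met at no mesh eventually ⟹ the X-clause (vacuously).**  The case `M = 0` of
`afToOnset_clause_of_bddOnset`, recorded for the onset `sInf ∅ = 0` of a format that fails at every mesh. [folklore] -/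
theorem afToOnset_clause_of_onset_eq_zero (bstar : ℝ → ℕ) {β₀ : ℝ} (hzero : ∀ β : ℝ, β₀ ≤ β → bstar β = 0)
    (v : 𝓢((EuclideanSpace ℝ (Fin 4)), ℝ)) (hv : tsupport v ⊆ {y : (EuclideanSpace ℝ (Fin 4)) | 0 < y 0})
    {η : ℝ} (hη : 0 < η) :
    ∃ T β₁ : ℝ, ∀ β : ℝ, β₁ ≤ β → ∀ s : ℝ, 0 < s → T ≤ s * (bstar β : ℝ) →
      ∃ᶠ (L : ℕ) in atTop, |Q2 G r β L s (thetaTest 4 v) v| ≤ η :=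
  afToOnset_clause_of_bddOnset r bstar (M := 0) (fun β hβ => (hzero β hβ).le) v hv hη

end Onset

end Summit.QuantumFields.YangMills.Cruxes.IR.AfOnset

end
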